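import Literature.NumberTheory.EllipticCurves.LatticeInclusionRigidityProofs
import Literature.NumberTheory.EllipticCurves.LatticeTransformationIdentity
import Mathlib.Algebra.Polynomial.Lifts
import Mathlib.RingTheory.EuclideanDomain
import Mathlib.RingTheory.Polynomial.Content
import HarnessLib

/-!
# For lattices `Λ ⊆ Λ'` with rational invariants, `℘_{Λ'} = T(℘_Λ)` with `T ∈ ℚ(X)`

Topic `NumberTheory/EllipticCurves`; a proofs-only file (theorems only: no definitions, no named
facts) in `namespace PeriodPair` (deliberate dot-notation extensions of Mathlib's `PeriodPair`,
as in the sibling files `LatticeInclusionRationalProofs.lean`,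
`LatticeInclusionRigidityProofs.lean`, `LatticeTransformationIdentity.lean`).

For lattices `Λ ⊆ Λ'` (period pairs `L ≤ L'`) the tree has `℘_{Λ'} = (P/Q)(℘_Λ)` with
`P, Q ∈ ℂ[X]` (`exists_polynomial_weierstrassP_mul_eval_eq_of_le`; Lawden §9.8) — the
`x`-coordinate of the isogeny `ℂ/Λ → ℂ/Λ'`, `z ↦ z` (Silverman, *AEC*, Thm. VI.4.1) — and the
algebraic certificate of the inclusion

  `(P′Q − PQ′)²·(4X³ − g₂X − g₃) = Q·(4P³ − g₂′PQ² − g₃′Q³)`    (∗)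

(`transformation_polynomial_identity`). This file descends `T = P/Q` to `ℚ(X)` when the
invariants `g₂, g₃, g₂′, g₃′` are rational — the statement that the isogeny between the
elliptic curves `y² = 4x³ − g₂x − g₃` and `y² = 4x³ − g₂′x − g₃′` over `ℚ` attached to
`Λ ⊆ Λ'` is itself defined over `ℚ` — by the `Aut(ℂ)`-argument "`σ` was an arbitrary
automorphism of `ℂ`" (Cox, *Primes of the form x² + ny²*, §10.C; the tree's
`LatticeInclusionRigidityProofs`, `CMEndomorphismOfCertificate`):

* `natDegree_lt_of_weierstrassP_mul_eval_eq` — `deg Q < deg P` (`T` has a pole at `∞`, as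
  `℘_{Λ'}(z) → ∞` when `℘_Λ(z) → ∞`, i.e. `z → 0`);
* `exists_eq_weierstrassP_comp_of_transformation_polynomial_identity` — a non-constant solution
  `T` of (∗) satisfies `T(℘_Λ(z)) = ℘_{Λ'}(εz + c)`, `ε = ±1` (the body of the tree's
  `lattice_le_of_transformation_polynomial_identity`: uniqueness theorem for the Weierstrass
  equation, Whittaker–Watson §20.22), and `const_mem_lattice_of_eq_weierstrassP_comp` — if
  `deg Q < deg P` then `c ∈ Λ'` (pole at `z = 0`; cf. the tree's
  `const_mem_lattice_of_natDegree_lt` for complex multiplications);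
* `map_mul_eq_mul_map_of_weierstrassP_mul_eval_eq` — **rigidity of `T`**: for every field
  automorphism `σ` of `ℂ` fixing `g₂, g₃, g₂′, g₃′` one has `P^σ·Q = P·Q^σ`, i.e. `T^σ = T`:
  `σ` transports (∗), so `T^σ(℘_Λ) = ℘_{Λ'}(εz + c)` with `c ∈ Λ'`, which is `℘_{Λ'}(z)` by
  periodicity and evenness, and two rational functions of `℘_Λ` agreeing off a countable set
  are equal;
* `Polynomial.exists_rat_map_of_forall_map_mul_eq` — **descent of an `Aut(ℂ)`-invariant
  fraction**: if `P^σ·Q = P·Q^σ` for all `σ ∈ Aut(ℂ)` then `P/Q = P₀/Q₀` with `P₀, Q₀ ∈ ℚ[X]`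
  coprime, `Q₀` monic (reduce the fraction and normalise the denominator; the reduced pair is
  then fixed coefficientwise, and a complex number fixed by `Aut(ℂ)` is rational,
  `exists_ratCast_eq_of_forall_ringEquiv`);
* `exists_rat_polynomial_weierstrassP_mul_eval_eq_of_le` — **main statement**: if
  `g₂, g₃, g₂′, g₃′ ∈ ℚ` then `℘_{Λ'}·Q₀(℘_Λ) = P₀(℘_Λ)` off `Λ'` with `P₀, Q₀ ∈ ℚ[X]` coprime,
  `Q₀` monic and `Q₀(℘_Λ) ≠ 0` off `Λ'`;
* `derivWeierstrassP_mul_eval_sq_eq_of_le` — the `y`-coordinate: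
  `℘′_{Λ'}·Q(℘_Λ)² = ℘′_Λ·(P′Q − PQ′)(℘_Λ)` (chain rule).

These serve the construction of the `ℚ`-rational isogeny between two elliptic curves over `ℚ`
whose Néron-type period lattices satisfy `cΛ₁ ⊆ Λ₂`, `c ∈ ℚˣ`. Everything is proved; no named
facts are introduced and no statement of the tree is changed.

## References

* J. H. Silverman, *The Arithmetic of Elliptic Curves*, 2nd ed., GTM 106, Springer 2009:
  Thm. VI.4.1, Thm. VI.5.3, III.4. [SilvermanAEC2009]
* D. A. Cox, *Primes of the form x² + ny²*, 2nd ed., Wiley 2013: §10.C (proof of Thm. 10.23),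
  Prop. 14.9. [Cox2013]
* D. F. Lawden, *Elliptic Functions and Applications*, Springer 1989: §9.8. [Lawden1989]
* E. T. Whittaker, G. N. Watson, *A Course of Modern Analysis*, 4th ed., Cambridge 1927: §20.22.
  [WhittakerWatson1927]
-/

noncomputable section

open Complex Set Polynomial Filter Topology Bornology
open Literature.NumberTheory.EllipticCurves Literature.FieldTheory.AlgClosed

/-! ### Descent of an `Aut(ℂ)`-invariant rational function to `ℚ(X)` -/

/-- **An `Aut(ℂ)`-invariant rational function has rational coefficients.** Let `P, Q ∈ ℂ[X]`,
`Q ≠ 0`, and suppose `P^σ·Q = P·Q^σ` (i.e. `(P/Q)^σ = P/Q`) for every field automorphism `σ`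
of `ℂ`, acting on coefficients. Then `P·Q₀ = P₀·Q` (i.e. `P/Q = P₀/Q₀`) for coprime
`P₀, Q₀ ∈ ℚ[X]` with `Q₀` monic. Proof: reduce `P/Q = P₂/Q₂` with `P₂, Q₂` coprime and `Q₂`
monic; then `P₂·Q₂^σ = P₂^σ·Q₂`, so `Q₂ ∣ Q₂^σ` and `Q₂^σ ∣ Q₂` (coprimality is preserved by
`σ`), whence `Q₂^σ = Q₂` (both monic) and `P₂^σ = P₂`; every coefficient is fixed by `Aut(ℂ)`,
hence rational (`exists_ratCast_eq_of_forall_ringEquiv`; Cox, proof of Thm. 10.23), and the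
pair lifts to `ℚ[X]` (Mathlib `Polynomial.lifts`). [cite: Cox2013, §10.C proof of Thm. 10.23] -/
theorem Polynomial.exists_rat_map_of_forall_map_mul_eq {P Q : ℂ[X]} (hQ0 : Q ≠ 0)
    (h : ∀ σ : ℂ ≃+* ℂ, P.map (σ : ℂ →+* ℂ) * Q = P * Q.map (σ : ℂ →+* ℂ)) :
    ∃ P₀ Q₀ : ℚ[X], Q₀.Monic ∧ IsCoprime P₀ Q₀ ∧
      P * Q₀.map (algebraMap ℚ ℂ) = P₀.map (algebraMap ℚ ℂ) * Q := by
  classical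
  -- reduce the fraction `P/Q`
  set g : ℂ[X] := GCDMonoid.gcd P Q with hg
  have hg0 : g ≠ 0 := gcd_ne_zero_of_right hQ0
  set P₁ : ℂ[X] := P / g with hP₁def
  set Q₁ : ℂ[X] := Q / g with hQ₁def
  have hP₁ : g * P₁ = P := EuclideanDomain.mul_div_cancel' hg0 (GCDMonoid.gcd_dvd_left P Q)
  have hQ₁ : g * Q₁ = Q := EuclideanDomain.mul_div_cancel' hg0 (GCDMonoid.gcd_dvd_right P Q)
  have hcop₁ : IsCoprime P₁ Q₁ := isCoprime_div_gcd_div_gcd hQ0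
  have hQ₁0 : Q₁ ≠ 0 := by
    intro h0; apply hQ0; rw [← hQ₁, h0, mul_zero]
  set u : ℂ := Q₁.leadingCoeff with hu
  have hu0 : u ≠ 0 := leadingCoeff_ne_zero.mpr hQ₁0
  set Q₂ : ℂ[X] := Q₁ * C u⁻¹ with hQ₂
  set P₂ : ℂ[X] := P₁ * C u⁻¹ with hP₂
  have hQ₂m : Q₂.Monic := monic_mul_leadingCoeff_inv hQ₁0
  have hunit : IsUnit (C u⁻¹) := isUnit_C.mpr (IsUnit.mk0 _ (inv_ne_zero hu0))
  have hcop₂ : IsCoprime P₂ Q₂ := (isCoprime_mul_unit_right hunit P₁ Q₁).mpr hcop₁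
  have hrel : P * Q₂ = P₂ * Q := by
    simp only [hQ₂, hP₂]
    rw [← hP₁, ← hQ₁]
    ring
  -- the reduced pair is fixed by `Aut(ℂ)`
  have hinv : ∀ σ : ℂ ≃+* ℂ, P₂.map (σ : ℂ →+* ℂ) = P₂ ∧ Q₂.map (σ : ℂ →+* ℂ) = Q₂ := by
    intro σ
    have hσinj : Function.Injective (σ : ℂ →+* ℂ) := σ.injective
    have e3 := h σ
    have e2 : P.map (σ : ℂ →+* ℂ) * Q₂.map (σ : ℂ →+* ℂ) =
        P₂.map (σ : ℂ →+* ℂ) * Q.map (σ : ℂ →+* ℂ) := by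
      rw [← Polynomial.map_mul, hrel, Polynomial.map_mul]
    have hQσ0 : Q.map (σ : ℂ →+* ℂ) ≠ 0 := (Polynomial.map_ne_zero_iff hσinj).mpr hQ0
    have e4 : P₂ * Q₂.map (σ : ℂ →+* ℂ) = P₂.map (σ : ℂ →+* ℂ) * Q₂ := by
      refine mul_right_cancel₀ (mul_ne_zero hQ0 hQσ0) ?_
      linear_combination (-(Q₂.map (σ : ℂ →+* ℂ) * Q.map (σ : ℂ →+* ℂ))) * hrel
        + (-(Q₂ * Q₂.map (σ : ℂ →+* ℂ))) * e3 + (Q₂ * Q) * e2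
    have hQ₂σm : (Q₂.map (σ : ℂ →+* ℂ)).Monic := hQ₂m.map _
    have hcopσ : IsCoprime (P₂.map (σ : ℂ →+* ℂ)) (Q₂.map (σ : ℂ →+* ℂ)) :=
      (isCoprime_map (σ : ℂ →+* ℂ)).mpr hcop₂
    have hd1 : Q₂ ∣ Q₂.map (σ : ℂ →+* ℂ) := by
      have : Q₂ ∣ P₂ * Q₂.map (σ : ℂ →+* ℂ) := by rw [e4]; exact dvd_mul_left _ _
      exact hcop₂.symm.dvd_of_dvd_mul_left this
    have hd2 : Q₂.map (σ : ℂ →+* ℂ) ∣ Q₂ := by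
      have : Q₂.map (σ : ℂ →+* ℂ) ∣ P₂.map (σ : ℂ →+* ℂ) * Q₂ := by
        rw [← e4]; exact dvd_mul_left _ _
      exact hcopσ.symm.dvd_of_dvd_mul_left this
    have hQeq : Q₂.map (σ : ℂ →+* ℂ) = Q₂ :=
      eq_of_monic_of_associated hQ₂σm hQ₂m (associated_of_dvd_dvd hd2 hd1)
    refine ⟨?_, hQeq⟩
    rw [hQeq] at e4
    exact (mul_right_cancel₀ hQ₂m.ne_zero e4).symm
  -- so its coefficients are rational, and the pair lifts to `ℚ[X]`
  have hcoefP : ∀ n, ∃ q : ℚ, (q : ℂ) = P₂.coeff n := fun n ↦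
    exists_ratCast_eq_of_forall_ringEquiv fun σ ↦ by
      simpa [Polynomial.coeff_map] using congrArg (fun p ↦ p.coeff n) (hinv σ).1
  have hcoefQ : ∀ n, ∃ q : ℚ, (q : ℂ) = Q₂.coeff n := fun n ↦
    exists_ratCast_eq_of_forall_ringEquiv fun σ ↦ by
      simpa [Polynomial.coeff_map] using congrArg (fun p ↦ p.coeff n) (hinv σ).2
  have hliftP : P₂ ∈ Polynomial.lifts (algebraMap ℚ ℂ) := by
    rw [lifts_iff_coeff_lifts]
    intro n
    obtain ⟨q, hq⟩ := hcoefP n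
    exact ⟨q, by rw [← hq, eq_ratCast]⟩
  have hliftQ : Q₂ ∈ Polynomial.lifts (algebraMap ℚ ℂ) := by
    rw [lifts_iff_coeff_lifts]
    intro n
    obtain ⟨q, hq⟩ := hcoefQ n
    exact ⟨q, by rw [← hq, eq_ratCast]⟩
  obtain ⟨P₀, hP₀⟩ := (mem_lifts _).mp hliftP
  obtain ⟨Q₀, hQ₀, -, hQ₀m⟩ := lifts_and_degree_eq_and_monic hliftQ hQ₂m
  refine ⟨P₀, Q₀, hQ₀m, ?_, ?_⟩
  · rw [← isCoprime_map (algebraMap ℚ ℂ), hP₀, hQ₀]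
    exact hcop₂
  · rw [hP₀, hQ₀]
    exact hrel

namespace PeriodPair

variable (L L' : PeriodPair)

/-! ### Preliminaries: zeros of `Q(℘_Λ)` -/

/-- For a nonzero polynomial `Q`, the zeros of `Q(℘_Λ)` off `Λ` form a countable set (each of
the finitely many roots of `Q` has a countable fibre under `℘_Λ`, a non-constant holomorphic
function on the connected set `ℂ ∖ Λ`). [folklore] -/
theorem countable_setOf_eval_weierstrassP_eq_zero {Q : ℂ[X]} (hQ : Q ≠ 0) :
    {z | z ∉ L.lattice ∧ Q.eval (℘[L] z) = 0}.Countable := by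
  classical
  have hΛpre : IsPreconnected ((L.lattice : Set ℂ)ᶜ) := by
    simpa [compl_eq_univ_sdiff] using
      isPreconnected_diff_of_countable (C := univ) convex_univ isOpen_univ L.countable_lattice
  have hΛconn : IsConnected ((L.lattice : Set ℂ)ᶜ) :=
    ⟨⟨L.ω₁ / 2, L.ω₁_div_two_notMem_lattice⟩, hΛpre⟩
  have hsub : {z | z ∉ L.lattice ∧ Q.eval (℘[L] z) = 0} ⊆
      ⋃ r ∈ (Q.roots.toFinset : Set ℂ), ((L.lattice : Set ℂ)ᶜ ∩ ℘[L] ⁻¹' {r}) := by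
    rintro z ⟨hzΛ, hr⟩
    simp only [mem_iUnion, mem_inter_iff, mem_compl_iff, mem_preimage, mem_singleton_iff,
      exists_prop, Finset.mem_coe, Multiset.mem_toFinset]
    exact ⟨℘[L] z, (mem_roots hQ).mpr hr, hzΛ, rfl⟩
  refine Countable.mono hsub ((Finset.countable_toSet _).biUnion fun r _ ↦ ?_)
  obtain ⟨z₁, hz₁, hz₁r⟩ := L.exists_weierstrassP_eq (r + 1)
  exact countable_inter_preimage_singleton_of_analyticOnNhd L.analyticOnNhd_weierstrassP hΛconn
    hz₁ (by rw [hz₁r]; simp)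

/-- A nonzero complex polynomial has no zeros near infinity. [folklore] -/
theorem _root_.Polynomial.eventually_cobounded_eval_ne_zero {Q : ℂ[X]} (hQ : Q ≠ 0) :
    ∀ᶠ x : ℂ in cobounded ℂ, Q.eval x ≠ 0 := by
  have hfin : {x : ℂ | Q.eval x = 0}.Finite :=
    (Q.roots.toFinset.finite_toSet).subset fun x hx ↦ by
      simp only [Finset.mem_coe, Multiset.mem_toFinset]
      exact (mem_roots hQ).mpr hx
  exact isBounded_def.mp hfin.isBounded

/-! ### The transformation has a pole at infinity: `deg Q < deg P` -/

/-- **`deg Q < deg P` for the transformation `℘_{Λ'} = (P/Q)(℘_Λ)`.** If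
`℘_{Λ'}(z)·Q(℘_Λ z) = P(℘_Λ z)` for all `z ∉ Λ'` with `Q ≠ 0`, then `deg Q < deg P`: otherwise
`(P/Q)(x)` has a finite limit as `x → ∞`, so `℘_{Λ'}(z) = (P/Q)(℘_Λ z)` would stay bounded as
`z → 0` (where `℘_Λ z → ∞`), whereas `℘_{Λ'}(z) → ∞`. (`T = P/Q` is the `x`-coordinate of the
isogeny `ℂ/Λ → ℂ/Λ'`, which maps `O ↦ O`; Silverman, *AEC*, Thm. VI.4.1 with III.4.)
[cite: SilvermanAEC2009, Thm. VI.4.1] -/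
theorem natDegree_lt_of_weierstrassP_mul_eval_eq {P Q : ℂ[X]} (hQ0 : Q ≠ 0)
    (hPQ : ∀ z ∉ L'.lattice, ℘[L'] z * Q.eval (℘[L] z) = P.eval (℘[L] z)) :
    Q.natDegree < P.natDegree := by
  by_contra! hle
  have hlc : Q.coeff Q.natDegree ≠ 0 := by
    rw [coeff_natDegree]; exact leadingCoeff_ne_zero.mpr hQ0
  have h1 := P.tendsto_eval_div_pow_cobounded hle
  have h2 := Q.tendsto_eval_div_pow_cobounded (le_refl Q.natDegree)
  have h3 : Tendsto (fun x : ℂ ↦ P.eval x / Q.eval x) (cobounded ℂ)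
      (𝓝 (P.coeff Q.natDegree / Q.coeff Q.natDegree)) := by
    refine (h1.div h2 hlc).congr' ?_
    filter_upwards [eventually_ne_cobounded (0 : ℂ)] with x hx
    rw [Pi.div_apply, div_div_div_cancel_right₀ (pow_ne_zero _ hx)]
  have h4 : Tendsto (fun ζ : ℂ ↦ P.eval (℘[L] ζ) / Q.eval (℘[L] ζ)) (𝓝[≠] 0)
      (𝓝 (P.coeff Q.natDegree / Q.coeff Q.natDegree)) :=
    h3.comp (L.tendsto_weierstrassP_cobounded (zero_mem _))
  have e1 : ∀ᶠ ζ : ℂ in 𝓝[≠] 0, ζ ∉ L'.lattice := L'.eventually_nhdsNE_notMem_lattice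
  have e3 : ∀ᶠ ζ : ℂ in 𝓝[≠] 0, Q.eval (℘[L] ζ) ≠ 0 :=
    (L.tendsto_weierstrassP_cobounded (zero_mem _)).eventually
      (eventually_cobounded_eval_ne_zero hQ0)
  have h5 : Tendsto ℘[L'] (𝓝[≠] 0) (𝓝 (P.coeff Q.natDegree / Q.coeff Q.natDegree)) := by
    refine h4.congr' ?_
    filter_upwards [e1, e3] with ζ h1 h3
    rw [← hPQ ζ h1, mul_div_cancel_right₀ _ h3]
  have h6 : Tendsto (fun ζ ↦ ‖℘[L'] ζ‖) (𝓝[≠] 0) atTop :=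
    tendsto_norm_cobounded_atTop.comp (L'.tendsto_weierstrassP_cobounded (zero_mem _))
  exact h5.norm.not_tendsto (disjoint_nhds_atTop _) h6

/-! ### Solutions of the algebraic certificate are translates of `℘_{Λ'}` -/

/-- **A non-constant solution of (∗) is `℘_{Λ'}(εz + c)` as a function of `℘_Λ`.** Let
`P, Q ∈ ℂ[X]`, `Q ≠ 0`, `P/Q` not constant, satisfy
`(P′Q − PQ′)²·(4X³ − g₂X − g₃) = Q·(4P³ − g₂′PQ² − g₃′Q³)` for the invariants of `Λ` and
`Λ'`. Then there are `ε = ±1` and `c ∈ ℂ` with `(P/Q)(℘_Λ z) = ℘_{Λ'}(εz + c)` whenever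
`z ∉ Λ`, `Q(℘_Λ z) ≠ 0` and `εz + c ∉ Λ'`. This is the body of the tree's
`lattice_le_of_transformation_polynomial_identity` (the function `w = (P/Q)(℘_Λ)` solves
`w′² = 4w³ − g₂′w − g₃′` on a co-countable connected open set and is not a constant root of the
cubic; uniqueness theorem `exists_eq_weierstrassP_of_deriv_sq`, Whittaker–Watson §20.22), with
the representation exported instead of the inclusion. [cite: WhittakerWatson1927, §20.22] -/
theorem exists_eq_weierstrassP_comp_of_transformation_polynomial_identity {P Q : ℂ[X]}
    (hQ : Q ≠ 0) (hnc : ∀ k : ℂ, P ≠ C k * Q)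
    (hid : (derivative P * Q - P * derivative Q) ^ 2 * (4 * X ^ 3 - C L.g₂ * X - C L.g₃) =
      Q * (4 * P ^ 3 - C L'.g₂ * P * Q ^ 2 - C L'.g₃ * Q ^ 3)) :
    ∃ ε : ℂ, (ε = 1 ∨ ε = -1) ∧ ∃ c : ℂ, ∀ z ∉ L.lattice, Q.eval (℘[L] z) ≠ 0 →
      ε * z + c ∉ L'.lattice → P.eval (℘[L] z) / Q.eval (℘[L] z) = ℘[L'] (ε * z + c) := by
  classical
  -- the domain `V` and its basic properties
  set V : Set ℂ := {z | z ∉ L.lattice ∧ Q.eval (℘[L] z) ≠ 0} with hV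
  have hΛo : IsOpen ((L.lattice : Set ℂ)ᶜ) := L.isClosed_lattice.isOpen_compl
  have hVo : IsOpen V := by
    have hVeq : V = (L.lattice : Set ℂ)ᶜ ∩ ℘[L] ⁻¹' ((fun x ↦ Q.eval x) ⁻¹' {0}ᶜ) := by
      ext z; simp [hV]
    rw [hVeq]
    exact L.differentiableOn_weierstrassP.continuousOn.isOpen_inter_preimage hΛo
      (isOpen_compl_singleton.preimage Q.continuous)
  have hcount : (univ \ V).Countable := by
    have hsub : univ \ V ⊆ (L.lattice : Set ℂ) ∪ {z | z ∉ L.lattice ∧ Q.eval (℘[L] z) = 0} := by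
      intro z hz
      by_cases hzΛ : z ∈ L.lattice
      · exact Or.inl hzΛ
      · right
        refine ⟨hzΛ, ?_⟩
        by_contra hne
        exact hz.2 ⟨hzΛ, hne⟩
    exact Countable.mono hsub (L.countable_lattice.union
      (L.countable_setOf_eval_weierstrassP_eq_zero hQ))
  have hVcompl : Vᶜ.Countable := by simpa [compl_eq_univ_sdiff] using hcount
  -- the function `w = (P/Q)(℘)` on `V`
  set w : ℂ → ℂ := fun z ↦ P.eval (℘[L] z) / Q.eval (℘[L] z) with hw
  have hPa : ∀ x, AnalyticAt ℂ (fun x ↦ P.eval x) x := fun x ↦ P.differentiable.analyticAt x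
  have hQa : ∀ x, AnalyticAt ℂ (fun x ↦ Q.eval x) x := fun x ↦ Q.differentiable.analyticAt x
  have hwan : AnalyticOnNhd ℂ w V := fun z hz ↦
    ((hPa _).comp (L.analyticOnNhd_weierstrassP z hz.1)).div
      ((hQa _).comp (L.analyticOnNhd_weierstrassP z hz.1)) hz.2
  have hvan : AnalyticOnNhd ℂ (fun z : ℂ ↦ z) V := fun z _ ↦ analyticAt_id
  -- the differential equation on `V`
  have hode : ∀ z ∈ V, deriv w z ^ 2 =
      deriv (fun z : ℂ ↦ z) z ^ 2 * (4 * w z ^ 3 - L'.g₂ * w z - L'.g₃) := by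
    intro z hz
    rw [deriv_id'', one_pow, one_mul]
    exact L.deriv_sq_eq_of_transformation_polynomial_identity L' hid hz.1 hz.2
  -- `w` is not a constant root of the cubic
  have hVne : V.Nonempty := by
    by_contra hVe
    rw [not_nonempty_iff_eq_empty] at hVe
    exact not_countable_complex (by simpa [hVe] using hVcompl)
  have hex : ∃ z₀ ∈ V, 4 * w z₀ ^ 3 - L'.g₂ * w z₀ - L'.g₃ ≠ 0 := by
    by_contra! hall
    set R : ℂ[X] := 4 * X ^ 3 - C L'.g₂ * X - C L'.g₃ with hR
    have hR3 : R.coeff 3 = 4 := by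
      simp [hR]
    have hR0 : R ≠ 0 := by
      intro h0
      rw [h0, coeff_zero] at hR3
      norm_num at hR3
    have hmaps : MapsTo w V (R.roots.toFinset : Set ℂ) := by
      intro z hz
      rw [Finset.mem_coe, Multiset.mem_toFinset, mem_roots hR0, IsRoot.def]
      simp only [hR, eval_sub, eval_mul, eval_pow, eval_X, eval_C, eval_ofNat]
      exact hall z hz
    have hVpre : IsPreconnected V := by
      simpa [compl_eq_univ_sdiff] using
        isPreconnected_diff_of_countable (C := univ) convex_univ isOpen_univ hcount
    obtain ⟨z₁, hz₁⟩ := hVne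
    have hconst : ∀ z ∈ V, w z = w z₁ := fun z hz ↦
      hVpre.constant_of_mapsTo (Finset.finite_toSet _).isDiscrete hwan.continuousOn hmaps hz hz₁
    apply hnc (w z₁)
    have hroots : ℘[L] '' V ⊆ {x | (P - C (w z₁) * Q).IsRoot x} := by
      rintro _ ⟨z, hz, rfl⟩
      have h1 : P.eval (℘[L] z) / Q.eval (℘[L] z) = w z₁ := hconst z hz
      rw [div_eq_iff hz.2] at h1
      simp only [mem_setOf_eq, IsRoot.def, eval_sub, eval_mul, eval_C]
      rw [h1]
      ring
    have hinf : {x | (P - C (w z₁) * Q).IsRoot x}.Infinite :=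
      (L.infinite_image_weierstrassP hVcompl).mono hroots
    exact sub_eq_zero.mp ((P - C (w z₁) * Q).eq_zero_of_infinite_isRoot hinf)
  obtain ⟨z₀, hz₀, h0⟩ := hex
  -- the uniqueness theorem: `w = ℘_{Λ'}(εz + c)`
  obtain ⟨ε, hε, c, -, hglob⟩ := L'.exists_eq_weierstrassP_of_deriv_sq (C := univ) convex_univ
    isOpen_univ hVo (subset_univ V) hcount hwan hvan hode hz₀ h0
  exact ⟨ε, hε, c, fun z hz hq hzc ↦ hglob z ⟨hz, hq⟩ hzc⟩

/-- **The translation constant is a period when `deg Q < deg P`.** If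
`(P/Q)(℘_Λ z) = ℘_{Λ'}(εz + c)` whenever `z ∉ Λ`, `Q(℘_Λ z) ≠ 0`, `εz + c ∉ Λ'`, with `Q ≠ 0`
and `deg Q < deg P`, then `c ∈ Λ'`: otherwise `℘_{Λ'}(εz + c) → ℘_{Λ'}(c)` as `z → 0`, whereas
`‖(P/Q)(℘_Λ z)‖ → ∞` because `℘_Λ(z) → ∞` (the two-lattice form of the tree's
`const_mem_lattice_of_natDegree_lt`). [folklore] -/
theorem const_mem_lattice_of_eq_weierstrassP_comp {ε c : ℂ} {P Q : ℂ[X]} (hQ0 : Q ≠ 0)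
    (hdeg : Q.natDegree < P.natDegree)
    (h : ∀ z ∉ L.lattice, Q.eval (℘[L] z) ≠ 0 → ε * z + c ∉ L'.lattice →
      P.eval (℘[L] z) / Q.eval (℘[L] z) = ℘[L'] (ε * z + c)) :
    c ∈ L'.lattice := by
  by_contra hc'
  have hopen : IsOpen ((L'.lattice : Set ℂ)ᶜ) := L'.isClosed_lattice.isOpen_compl
  have hcont : ContinuousAt (fun ζ : ℂ ↦ ℘[L'] (ε * ζ + c)) 0 := by
    have h℘ : ContinuousAt ℘[L'] ((fun ζ : ℂ ↦ ε * ζ + c) 0) :=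
      (L'.analyticOnNhd_weierstrassP _ (by simpa using hc')).continuousAt
    exact ContinuousAt.comp (g := ℘[L']) (f := fun ζ : ℂ ↦ ε * ζ + c) (x := 0) h℘ (by fun_prop)
  have hlhs : Tendsto (fun ζ : ℂ ↦ ‖℘[L'] (ε * ζ + c)‖) (𝓝[≠] 0) (𝓝 ‖℘[L'] (ε * 0 + c)‖) :=
    (hcont.tendsto.mono_left nhdsWithin_le_nhds).norm
  have hrhs : Tendsto (fun ζ : ℂ ↦ ‖P.eval (℘[L] ζ) / Q.eval (℘[L] ζ)‖) (𝓝[≠] 0) atTop :=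
    (tendsto_norm_eval_div_eval_atTop hQ0 hdeg).comp (L.tendsto_weierstrassP_cobounded (zero_mem _))
  have e1 : ∀ᶠ ζ : ℂ in 𝓝[≠] 0, ζ ∉ L.lattice := L.eventually_nhdsNE_notMem_lattice
  have e2 : ∀ᶠ ζ : ℂ in 𝓝[≠] 0, ε * ζ + c ∉ L'.lattice := by
    have hc1 : Continuous fun ζ : ℂ ↦ ε * ζ + c := by fun_prop
    have : (fun ζ : ℂ ↦ ε * ζ + c) ⁻¹' (L'.lattice : Set ℂ)ᶜ ∈ 𝓝 (0 : ℂ) :=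
      hc1.continuousAt.preimage_mem_nhds (hopen.mem_nhds (by simpa using hc'))
    exact mem_nhdsWithin_of_mem_nhds this
  have e3 : ∀ᶠ ζ : ℂ in 𝓝[≠] 0, Q.eval (℘[L] ζ) ≠ 0 :=
    (L.tendsto_weierstrassP_cobounded (zero_mem _)).eventually
      (eventually_cobounded_eval_ne_zero hQ0)
  have heq : (fun ζ : ℂ ↦ ‖℘[L'] (ε * ζ + c)‖) =ᶠ[𝓝[≠] 0]
      fun ζ : ℂ ↦ ‖P.eval (℘[L] ζ) / Q.eval (℘[L] ζ)‖ := by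
    filter_upwards [e1, e2, e3] with ζ h1 h2 h3
    rw [h ζ h1 h3 h2]
  exact (hlhs.congr' heq).not_tendsto (disjoint_nhds_atTop _) hrhs

/-! ### Rigidity of the transformation under `Aut(ℂ)` -/

/-- **The transformation `T = P/Q` with `℘_{Λ'} = T(℘_Λ)` is fixed by every automorphism of `ℂ`
fixing the invariants of `Λ` and `Λ'`.** Let `Λ ⊆ Λ'`, `Q ≠ 0`, `Q(℘_Λ z) ≠ 0` and
`℘_{Λ'}(z)·Q(℘_Λ z) = P(℘_Λ z)` for `z ∉ Λ'`, and let `σ : ℂ ≃+* ℂ` fix `g₂, g₃, g₂′, g₃′`.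
Then `P^σ·Q = P·Q^σ` in `ℂ[X]`. Proof: `σ` maps the certificate (∗)
(`transformation_polynomial_identity`) to the same identity for `(P^σ, Q^σ)`, so
`(P^σ/Q^σ)(℘_Λ z) = ℘_{Λ'}(εz + c)`
(`exists_eq_weierstrassP_comp_of_transformation_polynomial_identity`) with `c ∈ Λ'`
(`const_mem_lattice_of_eq_weierstrassP_comp`, as `deg Q^σ = deg Q < deg P = deg P^σ`), which is
`℘_{Λ'}(z) = (P/Q)(℘_Λ z)` by periodicity and evenness; the polynomial `P^σQ − PQ^σ` thus
vanishes on `℘_Λ` of a co-countable set, an infinite set (`infinite_image_weierstrassP`). This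
is the statement that the isogeny `E_Λ → E_{Λ'}`, `z ↦ z`, between curves with invariants in the
fixed field of `σ` is fixed by `σ` (Silverman, *AEC*, Thm. VI.4.1 (b) with VI.5.3; the
`Aut(ℂ)`-argument of Cox, §10.C). [cite: Cox2013, §10.C proof of Thm. 10.23] -/
theorem map_mul_eq_mul_map_of_weierstrassP_mul_eval_eq (h : L.lattice ≤ L'.lattice)
    {P Q : ℂ[X]} (hQ0 : Q ≠ 0) (hQ : ∀ z ∉ L'.lattice, Q.eval (℘[L] z) ≠ 0)
    (hPQ : ∀ z ∉ L'.lattice, ℘[L'] z * Q.eval (℘[L] z) = P.eval (℘[L] z))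
    (σ : ℂ ≃+* ℂ) (h₂ : σ L.g₂ = L.g₂) (h₃ : σ L.g₃ = L.g₃) (h₂' : σ L'.g₂ = L'.g₂)
    (h₃' : σ L'.g₃ = L'.g₃) :
    P.map (σ : ℂ →+* ℂ) * Q = P * Q.map (σ : ℂ →+* ℂ) := by
  classical
  have hid := L.transformation_polynomial_identity L' h hPQ
  -- `P/Q` is not constant
  have hnc : ∀ k : ℂ, P ≠ C k * Q := by
    intro k hk
    apply L'.not_eventually_const_weierstrassP L'.ω₁_div_two_notMem_lattice k
    filter_upwards [L'.isClosed_lattice.isOpen_compl.mem_nhds L'.ω₁_div_two_notMem_lattice]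
      with z hz
    have h1 := hPQ z hz
    rw [hk, eval_mul, eval_C] at h1
    exact mul_right_cancel₀ (hQ z hz) (by rw [h1])
  -- map the certificate by `σ`
  have hσinj : Function.Injective (σ : ℂ →+* ℂ) := σ.injective
  have hQσ : Q.map (σ : ℂ →+* ℂ) ≠ 0 := (Polynomial.map_ne_zero_iff hσinj).mpr hQ0
  have hncσ : ∀ k : ℂ, P.map (σ : ℂ →+* ℂ) ≠ C k * Q.map (σ : ℂ →+* ℂ) := by
    intro k hk
    apply hnc (σ.symm k)
    apply Polynomial.map_injective (σ : ℂ →+* ℂ) hσinj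
    rw [hk, Polynomial.map_mul, Polynomial.map_C]
    simp
  have hidσ := congrArg (Polynomial.map (σ : ℂ →+* ℂ)) hid
  simp only [Polynomial.map_mul, Polynomial.map_sub, Polynomial.map_pow,
    ← Polynomial.derivative_map, Polynomial.map_C, Polynomial.map_X, Polynomial.map_ofNat,
    RingHom.coe_coe, h₂, h₃, h₂', h₃'] at hidσ
  -- `(P^σ/Q^σ)(℘_Λ) = ℘_{Λ'}(εz + c)` with `c ∈ Λ'`
  obtain ⟨ε, hε, c, hc⟩ :=
    L.exists_eq_weierstrassP_comp_of_transformation_polynomial_identity L' hQσ hncσ hidσ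
  have hdeg : Q.natDegree < P.natDegree := L.natDegree_lt_of_weierstrassP_mul_eval_eq L' hQ0 hPQ
  have hdegσ : (Q.map (σ : ℂ →+* ℂ)).natDegree < (P.map (σ : ℂ →+* ℂ)).natDegree := by
    rwa [natDegree_map_eq_of_injective hσinj, natDegree_map_eq_of_injective hσinj]
  have hcΛ : c ∈ L'.lattice := L.const_mem_lattice_of_eq_weierstrassP_comp L' hQσ hdegσ hc
  -- hence `(P^σ/Q^σ)(℘_Λ) = ℘_{Λ'} = (P/Q)(℘_Λ)` off a countable set
  have key : ∀ z ∉ L'.lattice, (Q.map (σ : ℂ →+* ℂ)).eval (℘[L] z) ≠ 0 →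
      (P.map (σ : ℂ →+* ℂ) * Q - P * Q.map (σ : ℂ →+* ℂ)).IsRoot (℘[L] z) := by
    intro z hz hq
    have hzL : z ∉ L.lattice := fun h' ↦ hz (h h')
    have hεz : ε * z + c ∉ L'.lattice := by
      intro hmem
      have h1 : ε * z ∈ L'.lattice := by simpa using sub_mem hmem hcΛ
      rcases hε with rfl | rfl
      · exact hz (by simpa using h1)
      · exact hz (by simpa using h1)
    have h1 := hc z hzL hq hεz
    have h2 : ℘[L'] (ε * z + c) = ℘[L'] z := by
      have h2a : ℘[L'] (ε * z + c) = ℘[L'] (ε * z) := by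
        simpa using L'.weierstrassP_add_coe (ε * z) ⟨c, hcΛ⟩
      rw [h2a]
      rcases hε with rfl | rfl
      · rw [one_mul]
      · rw [neg_one_mul, L'.weierstrassP_neg]
    rw [h2, div_eq_iff hq] at h1
    have h3 := hPQ z hz
    simp only [IsRoot.def, eval_sub, eval_mul]
    rw [h1, ← h3]
    ring
  have hT : ({z : ℂ | z ∉ L'.lattice ∧ (Q.map (σ : ℂ →+* ℂ)).eval (℘[L] z) ≠ 0}ᶜ).Countable := by
    have hsub : {z : ℂ | z ∉ L'.lattice ∧ (Q.map (σ : ℂ →+* ℂ)).eval (℘[L] z) ≠ 0}ᶜ ⊆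
        (L'.lattice : Set ℂ) ∪
          {z | z ∉ L.lattice ∧ (Q.map (σ : ℂ →+* ℂ)).eval (℘[L] z) = 0} := by
      intro z hz
      simp only [mem_compl_iff, mem_setOf_eq, not_and, ne_eq, not_not] at hz
      by_cases hzΛ' : z ∈ L'.lattice
      · exact Or.inl hzΛ'
      · exact Or.inr ⟨fun h' ↦ hzΛ' (h h'), hz hzΛ'⟩
    exact Countable.mono hsub (L'.countable_lattice.union
      (L.countable_setOf_eval_weierstrassP_eq_zero hQσ))
  have hinf : {x | (P.map (σ : ℂ →+* ℂ) * Q - P * Q.map (σ : ℂ →+* ℂ)).IsRoot x}.Infinite := by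
    refine (L.infinite_image_weierstrassP hT).mono ?_
    rintro _ ⟨z, ⟨hz, hq⟩, rfl⟩
    exact key z hz hq
  exact sub_eq_zero.mp
    ((P.map (σ : ℂ →+* ℂ) * Q - P * Q.map (σ : ℂ →+* ℂ)).eq_zero_of_infinite_isRoot hinf)

/-! ### The transformation with rational coefficients -/

/-- **For `Λ ⊆ Λ'` with rational invariants, `℘_{Λ'}` is a rational function of `℘_Λ` over
`ℚ`.** If `Λ ⊆ Λ'` and `g₂(Λ), g₃(Λ), g₂(Λ'), g₃(Λ')` are rational, there are coprime
`P₀, Q₀ ∈ ℚ[X]`, `Q₀` monic, with `Q₀(℘_Λ z) ≠ 0` and `℘_{Λ'}(z)·Q₀(℘_Λ z) = P₀(℘_Λ z)` for all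
`z ∉ Λ'`: the transformation of the tree (`exists_polynomial_weierstrassP_mul_eval_eq_of_le`,
Lawden §9.8) is fixed by all of `Aut(ℂ)` (`map_mul_eq_mul_map_of_weierstrassP_mul_eval_eq`,
every `σ` fixing the rational invariants), hence descends to `ℚ(X)`
(`Polynomial.exists_rat_map_of_forall_map_mul_eq`); coprimality gives the non-vanishing of the
new denominator. Equivalently: the isogeny `z ↦ z` between the elliptic curves
`y² = 4x³ − g₂x − g₃` and `y² = 4x³ − g₂′x − g₃′` over `ℚ` has `x`-coordinate in `ℚ(x)`
(Silverman, *AEC*, Thm. VI.4.1 (b), VI.5.3, with the `Aut(ℂ)`-descent of Cox, §10.C).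
[cite: SilvermanAEC2009, Thm. VI.4.1] [cite: Cox2013, §10.C proof of Thm. 10.23] -/
theorem exists_rat_polynomial_weierstrassP_mul_eval_eq_of_le (h : L.lattice ≤ L'.lattice)
    (h₂ : ∃ q : ℚ, (q : ℂ) = L.g₂) (h₃ : ∃ q : ℚ, (q : ℂ) = L.g₃)
    (h₂' : ∃ q : ℚ, (q : ℂ) = L'.g₂) (h₃' : ∃ q : ℚ, (q : ℂ) = L'.g₃) :
    ∃ P₀ Q₀ : ℚ[X], Q₀.Monic ∧ IsCoprime P₀ Q₀ ∧
      (∀ z ∉ L'.lattice, (Q₀.map (algebraMap ℚ ℂ)).eval (℘[L] z) ≠ 0) ∧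
      ∀ z ∉ L'.lattice, ℘[L'] z * (Q₀.map (algebraMap ℚ ℂ)).eval (℘[L] z) =
        (P₀.map (algebraMap ℚ ℂ)).eval (℘[L] z) := by
  obtain ⟨P, Q, hQ0, hQ, hPQ⟩ := L.exists_polynomial_weierstrassP_mul_eval_eq_of_le L' h
  obtain ⟨q₂, hq₂⟩ := h₂
  obtain ⟨q₃, hq₃⟩ := h₃
  obtain ⟨q₂', hq₂'⟩ := h₂'
  obtain ⟨q₃', hq₃'⟩ := h₃'
  have hinv : ∀ σ : ℂ ≃+* ℂ, P.map (σ : ℂ →+* ℂ) * Q = P * Q.map (σ : ℂ →+* ℂ) := fun σ ↦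
    L.map_mul_eq_mul_map_of_weierstrassP_mul_eval_eq L' h hQ0 hQ hPQ σ
      (by rw [← hq₂, map_ratCast]) (by rw [← hq₃, map_ratCast])
      (by rw [← hq₂', map_ratCast]) (by rw [← hq₃', map_ratCast])
  obtain ⟨P₀, Q₀, hQ₀m, hcop, hrel⟩ := Polynomial.exists_rat_map_of_forall_map_mul_eq hQ0 hinv
  refine ⟨P₀, Q₀, hQ₀m, hcop, fun z hz h0 ↦ ?_, fun z hz ↦ ?_⟩
  · -- `Q₀(x) = 0` forces `P₀(x)·Q(x) = 0`, i.e. `P₀(x) = 0`, contradicting coprimality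
    have hrelx := congrArg (eval (℘[L] z)) hrel
    simp only [eval_mul, h0, mul_zero] at hrelx
    have hP0 : (P₀.map (algebraMap ℚ ℂ)).eval (℘[L] z) = 0 := by
      rcases mul_eq_zero.mp hrelx.symm with h' | h'
      · exact h'
      · exact absurd h' (hQ z hz)
    obtain ⟨a, b, hab⟩ := (isCoprime_map (algebraMap ℚ ℂ)).mpr hcop
    have h1 := congrArg (eval (℘[L] z)) hab
    simp only [eval_add, eval_mul, hP0, h0, mul_zero, add_zero, eval_one] at h1
    exact zero_ne_one h1
  · have hrelx := congrArg (eval (℘[L] z)) hrel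
    simp only [eval_mul] at hrelx
    have h1 := hPQ z hz
    refine mul_right_cancel₀ (hQ z hz) ?_
    linear_combination (Q₀.map (algebraMap ℚ ℂ)).eval (℘[L] z) * h1 + hrelx

/-! ### The `y`-coordinate: the derivative of the transformation -/

/-- **The derivative of the transformation.** If `Λ ⊆ Λ'` and
`℘_{Λ'}(z)·Q(℘_Λ z) = P(℘_Λ z)` for all `z ∉ Λ'`, then
`℘′_{Λ'}(z)·Q(℘_Λ z)² = ℘′_Λ(z)·(P′Q − PQ′)(℘_Λ z)` for all `z ∉ Λ'` (differentiate the
identity, which holds on the open set `ℂ ∖ Λ'`, by the chain rule) — the `y`-coordinate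
`y′ = T′(x)·y` of the isogeny `(x, y) ↦ (T(x), T′(x)y)`, `T = P/Q` (Silverman, *AEC*, III.4;
Cox, Prop. 14.9 for the complex-multiplication analogue, the tree's
`derivWeierstrassP_mul_of_transformation`). [folklore] -/
theorem derivWeierstrassP_mul_eval_sq_eq_of_le (h : L.lattice ≤ L'.lattice) {P Q : ℂ[X]}
    (hPQ : ∀ z ∉ L'.lattice, ℘[L'] z * Q.eval (℘[L] z) = P.eval (℘[L] z))
    {z : ℂ} (hz : z ∉ L'.lattice) :
    ℘'[L'] z * Q.eval (℘[L] z) ^ 2 =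
      ℘'[L] z * (derivative P * Q - P * derivative Q).eval (℘[L] z) := by
  have hzΛ : z ∉ L.lattice := fun h' ↦ hz (h h')
  have hG0 : (fun _ : ℂ ↦ (0 : ℂ)) =ᶠ[𝓝 z]
      fun w ↦ ℘[L'] w * Q.eval (℘[L] w) - P.eval (℘[L] w) := by
    filter_upwards [L'.isClosed_lattice.isOpen_compl.mem_nhds hz] with w hw
    rw [hPQ w hw, sub_self]
  have hd1 : HasDerivAt ℘[L'] (℘'[L'] z) z := L'.hasDerivAt_weierstrassP hz
  have hdQ : HasDerivAt (fun w ↦ Q.eval (℘[L] w))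
      ((derivative Q).eval (℘[L] z) * ℘'[L] z) z :=
    (Q.hasDerivAt (℘[L] z)).comp z (L.hasDerivAt_weierstrassP hzΛ)
  have hdP : HasDerivAt (fun w ↦ P.eval (℘[L] w))
      ((derivative P).eval (℘[L] z) * ℘'[L] z) z :=
    (P.hasDerivAt (℘[L] z)).comp z (L.hasDerivAt_weierstrassP hzΛ)
  have hdG := ((hd1.mul hdQ).sub hdP).congr_of_eventuallyEq hG0
  have E2 : ℘'[L'] z * Q.eval (℘[L] z) +
      ℘[L'] z * ((derivative Q).eval (℘[L] z) * ℘'[L] z) -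
      (derivative P).eval (℘[L] z) * ℘'[L] z = 0 :=
    hdG.unique (hasDerivAt_const z (0 : ℂ))
  have E1 := hPQ z hz
  simp only [eval_sub, eval_mul]
  linear_combination (Q.eval (℘[L] z)) * E2 - (℘'[L] z * (derivative Q).eval (℘[L] z)) * E1

end PeriodPair

end
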